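import Summits.QuantumFields.BalabanUV.Beta.GAN24.CombChargeRowsClosed
import Summits.QuantumFields.BalabanUV.Beta.GAN24.CombChartQuarticLawAn1

/-!
# `BalabanUV.Beta.GAN24.CombChargeRowsClosedAn1` — binder row G-an2-4 ∕ (CONV-C), TRANSFER-III, the (III′) (C)-row's END at row D1's literal of record:
# **THE G-an2-4 END ⟸ (b) ALONE — W-an2-1′ SUPPLIED BY NAME** — gen 53's R `CombChargeRowsClosed` (END ⟸ (b) ∧ W-an2-1′) with its eight an2-side binders
# `γ h hhL hh R2 hR2c hR2p hlaw` INHABITED by this gen's W54a `CombChartQuarticLawAn1.exists_quarticLaw_comb_an1` (an2's (III′) chain composed BY NAME).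
# WHAT THE G-an2-4 SIDE OF THE (III′) END DISPLAYS AFTER THIS FILE: **(b) the S-slot rows `hS ∕ hSall` of `ScombOf` — NOTHING ELSE** (road-P2's S-campaign; its gen-56
# M.104 `CombSRowsOfContactLetters` reduces them to six CONTACT letters) — under an1's record `Odd Lc`, `2 ≤ Lc`, `2 ≤ N`, `cΛ·Lc⁴ = 2`, `cB = −Lc¹²∕4`
# (G-an2-4 ∕ (CONV-C) OWNER `b2b-balaban-gan24-p1`, gen 54; journal [GAN24P1-G54-INTENT-2])

NOT IN PRINT; OUR BOOKKEEPING ([folklore] one composition BY NAME: R ∘ W54a; 0 `def`, 0 cited fact, 0 `def … : Prop`, 0 sorry).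
HONEST FRAMING (cell contract, verbatim): «discharging `BetaPertH` makes Bałaban's UV stability UNCONDITIONAL — a real constructive-QFT result; it is NOT the continuum limit and NOT
the Clay problem.»  HONEST DEPENDENCY (verbatim): «continuum YM on T⁴ ⇐ BetaPertH ∧ nine spine estimates (0/9 proved); BetaPertH ⇐ (D1) ∧ (D4) ∧ CAP+tail; G-an2-4 gates asym, D1
and NE2/3/4.»

WHAT (at an1's record of (III′)):
**`exists_allScalesSeq_JsB12CombShSym_an1_of_sRows`** — road FP's D1 literal `∃ κ θ<1, AllScalesSeq (j ↦ secondMoment (TbalOf Lc (JsB12CombShSym hLc N (symTablesAn1S2 3 Lc cΛ) cΛ cB) j) μ ν) κ θ`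
⟸ (b); **`d1Drift_JsB12CombShSym_an1_iff_lim_eq_of_sRows`** — row D1's reading ⟸ (b).  Asserts NO value of Bałaban's tables beyond an2's ∕ an1's DEFINED ones; (b) remains a
HYPOTHESIS; NEVER «G-an2-4 closed» as (CONV-C); NOT D1, NOT `BetaPertH`, NOT continuum, NOT Clay.  2026-08-28; no existing file touched.
-/

noncomputable section

open Finset
open scoped BigOperators
open Literature.MathematicalPhysics.QuantumFieldTheory
open Literature.MathematicalPhysics.QuantumFieldTheory.Balaban1983to89
open Literature.MathematicalPhysics.QuantumFieldTheory.Balaban1983to89.Beta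
open OneStepResolventKernel (Fib LocStencil)
open OneStepKernelFamily (TbalOf D1Drift)
open RemainderConstAllScales (AllScalesSeq)
open Summit.QuantumFields.BalabanUV.Beta.HessKerDressedUnits (unitS)
open Summit.QuantumFields.BalabanUV.Beta.CombChartStepJets (ScombOf)
open Summit.QuantumFields.BalabanUV.Beta.SymSecondOrderTablesAn1 (symTablesAn1S2)
open Summit.QuantumFields.BalabanUV.Beta.CombChartJointEnd (JsB12CombShSym)
open Summit.QuantumFields.BalabanUV.Beta.GAN24.CombesThomas (sfStep smStep)
open Summit.QuantumFields.BalabanUV.Beta.GAN24.CombChargeRowsClosed (exists_allScalesSeq_JsB12CombShSym_an1_of_sRows_law d1Drift_JsB12CombShSym_an1_iff_lim_eq_of_sRows_law)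
open Summit.QuantumFields.BalabanUV.Beta.GAN24.CombChartQuarticLawAn1 (exists_quarticLaw_comb_an1)

namespace Summit.QuantumFields.BalabanUV.Beta.GAN24.CombChargeRowsClosedAn1

variable {Lc : ℕ} [NeZero Lc]

set_option maxHeartbeats 1000000 in  -- R's junction carries large face-shape terms
set_option maxRecDepth 2048 in
/-- NOT IN PRINT; OUR BOOKKEEPING.  **THE G-an2-4 END AT ROW D1's LITERAL OF RECORD (III′) FROM (b) ALONE** — R with W-an2-1′ (`γ h hhL hh R2 hR2c hR2p hlaw`) supplied by
W54a `exists_quarticLaw_comb_an1`. -/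
theorem exists_allScalesSeq_JsB12CombShSym_an1_of_sRows (hLc : Odd Lc) (hLc2 : 2 ≤ Lc) {N : ℕ} (hN : 2 ≤ N) {cΛ cB : ℝ} (hΛ : cΛ * (Lc : ℝ) ^ 4 = 2)
    (hcB : cB = -((Lc : ℝ) ^ 12 / 4)) {Cs cS θS δS : ℝ}
    -- (b) the S-slot rows of `ScombOf` at an1's record (road-P2's S-campaign: `CombSRowsOfContactLetters` ⟸ six contact letters)
    (hS : ∀ j, LocStencil (unitS (sfStep Lc j) (smStep 3 Lc j) (ScombOf (symTablesAn1S2 3 Lc cΛ) ((Lc : ℝ) ^ 4) (-((Lc : ℝ) ^ 8 / 2)) cΛ j)) Cs δS)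
    (hSall : ∀ k j, LocStencil (unitS (sfStep Lc (k + j)) (smStep 3 Lc (k + j)) (ScombOf (symTablesAn1S2 3 Lc cΛ) ((Lc : ℝ) ^ 4) (-((Lc : ℝ) ^ 8 / 2)) cΛ (k + j)) -
      unitS (sfStep Lc k) (smStep 3 Lc k) (ScombOf (symTablesAn1S2 3 Lc cΛ) ((Lc : ℝ) ^ 4) (-((Lc : ℝ) ^ 8 / 2)) cΛ k)) (cS * θS ^ k) δS)
    (hδS : 0 < δS) (hθS0 : 0 ≤ θS) (hθS1 : θS < 1) (μ ν : Fin 4) :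
    ∃ κ θ : ℝ, 0 ≤ θ ∧ θ < 1 ∧ AllScalesSeq (fun j => B12Beta.secondMoment (TbalOf Lc (JsB12CombShSym hLc N (symTablesAn1S2 3 Lc cΛ) cΛ cB) j) μ ν) κ θ := by
  obtain ⟨γ, h, R2, hhL, hh, hR2c, hR2p, hlaw⟩ := exists_quarticLaw_comb_an1 (Lc := Lc) hLc hN hΛ hcB
  exact exists_allScalesSeq_JsB12CombShSym_an1_of_sRows_law hLc hLc2 hN hΛ hcB hS hSall hδS hθS0 hθS1 γ h hhL hh R2 hR2c hR2p hlaw μ ν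

set_option maxHeartbeats 1000000 in
set_option maxRecDepth 2048 in
/-- NOT IN PRINT; OUR BOOKKEEPING.  **ROW D1's READING FROM (b) ALONE** (the VALUE `lim β = stepBal Nc Lc` is row D1's and is NOT proved). -/
theorem d1Drift_JsB12CombShSym_an1_iff_lim_eq_of_sRows (hLc : Odd Lc) (hLc2 : 2 ≤ Lc) {N : ℕ} (hN : 2 ≤ N) {cΛ cB : ℝ} (hΛ : cΛ * (Lc : ℝ) ^ 4 = 2)
    (hcB : cB = -((Lc : ℝ) ^ 12 / 4)) {Cs cS θS δS : ℝ}
    (hS : ∀ j, LocStencil (unitS (sfStep Lc j) (smStep 3 Lc j) (ScombOf (symTablesAn1S2 3 Lc cΛ) ((Lc : ℝ) ^ 4) (-((Lc : ℝ) ^ 8 / 2)) cΛ j)) Cs δS)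
    (hSall : ∀ k j, LocStencil (unitS (sfStep Lc (k + j)) (smStep 3 Lc (k + j)) (ScombOf (symTablesAn1S2 3 Lc cΛ) ((Lc : ℝ) ^ 4) (-((Lc : ℝ) ^ 8 / 2)) cΛ (k + j)) -
      unitS (sfStep Lc k) (smStep 3 Lc k) (ScombOf (symTablesAn1S2 3 Lc cΛ) ((Lc : ℝ) ^ 4) (-((Lc : ℝ) ^ 8 / 2)) cΛ k)) (cS * θS ^ k) δS)
    (hδS : 0 < δS) (hθS0 : 0 ≤ θS) (hθS1 : θS < 1) (μ ν : Fin 4) (Nc : ℝ) :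
    D1Drift Lc (JsB12CombShSym hLc N (symTablesAn1S2 3 Lc cΛ) cΛ cB) Nc μ ν ↔
      RateCertificate.CauchyRate.lim (fun j => B12Beta.secondMoment (TbalOf Lc (JsB12CombShSym hLc N (symTablesAn1S2 3 Lc cΛ) cΛ cB) j) μ ν) =
        B12Normalization.stepBal Nc Lc := by
  obtain ⟨γ, h, R2, hhL, hh, hR2c, hR2p, hlaw⟩ := exists_quarticLaw_comb_an1 (Lc := Lc) hLc hN hΛ hcB
  exact d1Drift_JsB12CombShSym_an1_iff_lim_eq_of_sRows_law hLc hLc2 hN hΛ hcB hS hSall hδS hθS0 hθS1 γ h hhL hh R2 hR2c hR2p hlaw μ ν Nc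

end Summit.QuantumFields.BalabanUV.Beta.GAN24.CombChargeRowsClosedAn1

end
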